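import Summits.ResolutionOfSingularities.ResolutionOfSingularities.Theses.WeightedInvariant
import Summits.ResolutionOfSingularities.ResolutionOfSingularities.Theorems.WeightedInvariantTerminatingCentreDatumConsumer
import HarnessLib

/-!
# Crux `HypersurfaceCentreToResolution` modulo Bergh–Rydh (route `WeightedInvariant`, re-typed consumer)

Topic: `Summits/ResolutionOfSingularities/ResolutionOfSingularities/Theorems`.  The re-typed consumer item
of route `ResolutionOfSingularities/WeightedInvariant` is a theorem modulo the named Literature fact
`BerghRydh2019_diagonalizableQuotientResolution` (tame destackification), exactly as today's
`datumToEmbedded_of_berghRydh2019` is for `DatumToEmbedded`: the work is the sorry-free consumer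
`HypersurfaceTerminatingCentreDatum.hasResolution_field` of `…Theorems.WeightedInvariantTerminatingCentreDatumConsumer`.
Lands `--supports <item id of HypersurfaceCentreToResolution>` after TURNKEY steps 1, 2(+3), 5.  Text =
RepairSketch(G2).lean Part C §(2), farm rc 0 there.  [OURS · folklore]
-/

noncomputable section

open CategoryTheory AlgebraicGeometry
open Literature.AlgebraicGeometry.Resolution
open Summit.ResolutionOfSingularities.ResolutionOfSingularities.Theses.WeightedInvariant

set_option linter.dupNamespace false -- mandated namespace of this single-conjunct summit

namespace Summit.ResolutionOfSingularities.ResolutionOfSingularities.Theorems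

/-- **Consumer RH modulo Bergh–Rydh** (only its instances over perfect fields of characteristic `p`
are used). [cite: Wlodarczyk2022, Thm 1.1.6; BerghRydh2019, Thm 5] -/
theorem hypersurfaceCentreToResolution_of_berghRydh2019
    (hBR : BerghRydh2019_diagonalizableQuotientResolution) : HypersurfaceCentreToResolution := by
  intro p hp hE k _ _ _ X f hsep hlft hqc hred
  obtain ⟨E⟩ := hE
  haveI := hsep; haveI := hlft; haveI := hqc; haveI := hred
  exact HypersurfaceTerminatingCentreDatum.hasResolution_field hp E
    (fun V g _ _ _ _ hV => hBR k V g hV) X f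

/-- Sanity link: Bergh–Rydh + the re-typed door + descent ⇒ the Statement, through the route's own
deciding theorem `closes`. [folklore] -/
theorem resolution_of_berghRydh2019_of_hypersurfaceCentreConstruction
    (hBR : BerghRydh2019_diagonalizableQuotientResolution) (hC : HypersurfaceCentreConstruction)
    (hD : DescentPerfectToAll) : _root_.ResolutionOfSingularities :=
  closes hC (hypersurfaceCentreToResolution_of_berghRydh2019 hBR) hD

end Summit.ResolutionOfSingularities.ResolutionOfSingularities.Theorems

end
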